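import Mathlib
import Summits.Ventures.PercRepro.TriangleCapDeficiency

/-!
# PercRepro — THE RESIDUE BOUND ON THE DEFICIENCY: `Σ c (D − c) ≥ φ_D (Σ c)` ON EACH SIDE (p3, gen 55; part 301)

`φ_D(a) = (a mod D)(D − a mod D)` is SUBADDITIVE (`phiD_add_le`: with `α = a mod D`, `β = b mod D`,
`φ(a + b) = (α + β)(D − α − β)` or `(α + β − D)(2D − α − β)`, below `α(D − α) + β(D − β)` by `2 α β` resp.
`2 (D − α)(D − β)`), and `c (D − c) = φ_D(c)` for `c ≤ D`; so for every family of numbers `≤ D`,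
`Σ_i c_i (D − c_i) ≥ φ_D (Σ_i c_i)` (`sum_mul_sub_ge_phi`).  Applied to the two sides of the off-edge graph —
the non-neighbours carry `Σ_{x ∈ L} c(x) = t + |inside|`, the neighbours `Σ_{y ∈ N(w)} c(y) = attach = t − |inside|` —
the deficiency identity of part 279 gives THE RESIDUE BOUND (`band_ge_phi`):

  **`t (t − 1) + 2 |inside| + φ_D(t + |inside|) + φ_D(t − |inside|) ≤ 2 j + 2 t (D − 1)`**

for every graph of the band with every off-degree `≤ D`.  Without inside edges this is `2 φ_D(t) = 2 r (D − r)`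
(`r = t mod D`), the regular bound sharpened by the residue; WITH inside edges the right side can be smaller than
`2 r (D − r)` — `I = r` makes the rows full and costs `2 r + φ_D(2 r)` — which is how the g54 conjecture's
"else" branch (bottom `= C(t,2) − t(D − 1) + r(D − r)` for `t > D²`) fails at `ℓ = 7`, `t = 32`, `D = 5`
(`j = 372 < 374`, HOME/mining/p3/g55/cex32.py).  The minimum over `I` is `min(2 r (D − r), 2 min(r, D − r) + φ_D(2 r))`
(census, not needed here).  Axioms: standard.
-/

namespace PercRepro

namespace TriangleCap

namespace C047

open Finset

variable {V : Type*} [Fintype V] [DecidableEq V]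

/-- The residue deficiency `φ_D(a) = (a mod D)(D − a mod D)`. -/
def phiD (D a : ℕ) : ℕ := (a % D) * (D - a % D)

/-- `φ_D(c) = c (D − c)` for `c < D`. -/
theorem phiD_of_lt (D c : ℕ) (hc : c < D) : phiD D c = c * (D - c) := by
  unfold phiD
  rw [Nat.mod_eq_of_lt hc]

/-- `φ_D(D) = 0`. -/
theorem phiD_self (D : ℕ) : phiD D D = 0 := by
  unfold phiD
  simp

/-- `φ_D(c) ≤ c (D − c)` for `c ≤ D` (with equality). -/
theorem phiD_le_mul_sub (D c : ℕ) (hc : c ≤ D) : phiD D c ≤ c * (D - c) := by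
  rcases Nat.lt_or_ge c D with h | h
  · rw [phiD_of_lt D c h]
  · have : c = D := le_antisymm hc h
    subst this
    rw [phiD_self]
    exact Nat.zero_le _

/-- The core inequality: `(α + β)(D − α − β) ≤ α (D − α) + β (D − β)` for `α + β ≤ D` (the gap is `2 α β`). -/
theorem phi_core (D α β : ℕ) (h : α + β ≤ D) : (α + β) * (D - (α + β)) ≤ α * (D - α) + β * (D - β) := by
  obtain ⟨e, rfl⟩ : ∃ e, D = α + β + e := ⟨D - (α + β), by omega⟩
  have e1 : α + β + e - (α + β) = e := by omega
  have e2 : α + β + e - α = β + e := by omega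
  have e3 : α + β + e - β = α + e := by omega
  rw [e1, e2, e3]
  nlinarith [Nat.zero_le (α * β)]

/-- **THE SUBADDITIVITY OF `φ_D`:** `φ_D(a + b) ≤ φ_D(a) + φ_D(b)`. -/
theorem phiD_add_le (D a b : ℕ) : phiD D (a + b) ≤ phiD D a + phiD D b := by
  rcases Nat.eq_zero_or_pos D with rfl | hD
  · unfold phiD
    simp
  · unfold phiD
    rw [Nat.add_mod]
    have hα := Nat.mod_lt a hD
    have hβ := Nat.mod_lt b hD
    obtain ⟨α, hα'⟩ : ∃ α, a % D = α := ⟨_, rfl⟩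
    obtain ⟨β, hβ'⟩ : ∃ β, b % D = β := ⟨_, rfl⟩
    rw [hα'] at hα ⊢
    rw [hβ'] at hβ ⊢
    rcases Nat.lt_or_ge (α + β) D with hlt | hge
    · rw [Nat.mod_eq_of_lt hlt]
      exact phi_core D α β (le_of_lt hlt)
    · rw [Nat.mod_eq_sub_mod hge, Nat.mod_eq_of_lt (by omega)]
      -- with `α' = D − α`, `β' = D − β`: the core inequality for `(α', β')`
      have hcore := phi_core D (D - α) (D - β) (by omega)
      have e1 : D - (D - α + (D - β)) = α + β - D := by omega
      have e2 : D - (D - α) = α := by omega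
      have e3 : D - (D - β) = β := by omega
      rw [e1, e2, e3] at hcore
      have e4 : D - (α + β - D) = D - α + (D - β) := by omega
      rw [e4]
      calc (α + β - D) * (D - α + (D - β)) = (D - α + (D - β)) * (α + β - D) := by ring
        _ ≤ (D - α) * α + (D - β) * β := hcore
        _ = α * (D - α) + β * (D - β) := by ring

/-- **THE RESIDUE BOUND OF A SUM:** `φ_D (Σ_i c_i) ≤ Σ_i c_i (D − c_i)` for every family of numbers `≤ D`. -/
theorem sum_mul_sub_ge_phi {ι : Type*} (s : Finset ι) (c : ι → ℕ) (D : ℕ) (hc : ∀ i ∈ s, c i ≤ D) :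
    phiD D (∑ i ∈ s, c i) ≤ ∑ i ∈ s, c i * (D - c i) := by
  classical
  induction s using Finset.induction_on with
  | empty =>
    simp only [sum_empty]
    unfold phiD
    simp
  | insert a s ha ih =>
    rw [sum_insert ha, sum_insert ha]
    have h1 := phiD_add_le D (c a) (∑ i ∈ s, c i)
    have h2 := ih (fun i hi => hc i (mem_insert_of_mem hi))
    have h3 := phiD_le_mul_sub D (c a) (hc a (mem_insert_self a s))
    omega

/-- The off-degree sum of the non-neighbours: `Σ_{x ∈ L} c(x) = t + |inside|` (triangle-free). -/
theorem sum_offDeg_nonNbrs_eq_add_card_inside (H : SimpleGraph V) [DecidableRel H.Adj] (hfree : H.CliqueFree 3)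
    (w : V) : ∑ x ∈ nonNbrs H w, offDeg H w x = (offEdges H w).card + (insideEdges H w).card := by
  have h1 := sum_erase_offDeg H w
  rw [sum_erase_eq_nonNbrs_add_nbrs H w] at h1
  have h2 := attach_add_card_inside H hfree w
  unfold attach at h2
  omega

/-- **THE RESIDUE BOUND OF THE BAND:** for every triangle-free `H` with `s` edges, `w` of degree `s − t ≥ 1`, every
off-degree `≤ D`, at the band value `2 j`, with `I = |inside|`:
`t (t − 1) + 2 I + φ_D(t + I) + φ_D(t − I) ≤ 2 j + 2 t (D − 1)`. -/
theorem band_ge_phi (H : SimpleGraph V) [DecidableRel H.Adj] (hfree : H.CliqueFree 3) (s t j D : ℕ)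
    (hs : H.edgeFinset.card = s) (w : V) (hw : deg H w + t = s) (hw1 : 1 ≤ deg H w)
    (hj : ∑ v, deg H v * deg H v + 2 * (t * (s - t - 1)) + 2 * j = s * (s + 1))
    (hD : ∀ v, offDeg H w v ≤ D) :
    t * (t - 1) + 2 * (insideEdges H w).card + phiD D (t + (insideEdges H w).card) +
      phiD D (t - (insideEdges H w).card) ≤ 2 * j + 2 * (t * (D - 1)) := by
  have hid := deficiency_identity_split H hfree s t j D hs w hw hw1 hj hD
  have hcard := card_offEdges_add_deg H w
  have ht : (offEdges H w).card = t := by omega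
  have hL := sum_mul_sub_ge_phi (nonNbrs H w) (offDeg H w) D (fun x _ => hD x)
  have hR := sum_mul_sub_ge_phi (univ.filter (fun y => H.Adj w y)) (offDeg H w) D (fun y _ => hD y)
  have hsumL := sum_offDeg_nonNbrs_eq_add_card_inside H hfree w
  have hsumR := attach_add_card_inside H hfree w
  unfold attach at hsumR
  rw [ht] at hsumL hsumR
  rw [hsumL] at hL
  have hR' : ∑ y ∈ univ.filter (fun y => H.Adj w y), offDeg H w y = t - (insideEdges H w).card := by omega
  rw [hR'] at hR
  omega

/-- **THE RESIDUE BOUND WITHOUT INSIDE EDGES:** `t (t − 1) + 2 φ_D(t) ≤ 2 j + 2 t (D − 1)` when the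
non-neighbourhood is independent — the regular bound sharpened by `2 r (D − r)`, `r = t mod D`. -/
theorem band_ge_two_phi_of_no_inside (H : SimpleGraph V) [DecidableRel H.Adj] (hfree : H.CliqueFree 3)
    (s t j D : ℕ) (hs : H.edgeFinset.card = s) (w : V) (hw : deg H w + t = s) (hw1 : 1 ≤ deg H w)
    (hj : ∑ v, deg H v * deg H v + 2 * (t * (s - t - 1)) + 2 * j = s * (s + 1))
    (hD : ∀ v, offDeg H w v ≤ D) (hI : (insideEdges H w).card = 0) :
    t * (t - 1) + 2 * phiD D t ≤ 2 * j + 2 * (t * (D - 1)) := by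
  have h := band_ge_phi H hfree s t j D hs w hw hw1 hj hD
  rw [hI] at h
  simp only [mul_zero, add_zero, Nat.sub_zero] at h
  omega

end C047

end TriangleCap

end PercRepro
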